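import Mathlib
import HarnessLib
import HarnessLib.Audit
import Summits.AtomisticToContinuum.Statement

/-!
Route: DissipativeWeakStrong

CLOSED (retired) 2026-08-15T13:41:49Z by operator:999:1257524 — reason: not-a-thesis: assembly does not conclude the sub-problem Statement — note: D-0027 §2.1 audit (human 2026-08-15: routes that do not decide the summit are removed): the assembly concludes `Literature.MathematicalPhysics.KineticTheory.HydrodynamicLimit`, not the sub-problem statement; a NEW conforming route may be opened from the same idea (generated `closes : … → _root_.Hydr. The file is kept as the record of this route; refuted decls are indexed as negative knowledge (`ledger negatives`).

X_WS (COMPACTNESS + DISSIPATIVE MEASURE-VALUED EULER + RELATIVE-ENERGY WEAK–STRONG UNIQUENESS; it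
suffices to show):
(a) FLUX CLOSURE WITH ADMISSIBILITY [informal]: for σ < σ₀ and local Gibbs data, along any
subsequence the joint law of
    the empirical conserved fields U_N = (density, momentum, energy) and of the time-integrated
empirical momentum-flux and
    energy-flux fields is tight on [0,T)×𝕋³, and every limit point is a.s. a DISSIPATIVE
MEASURE-VALUED solution of the
    hs-Euler system: fluxes are the Young-measure averages of (ρu⊗u + ρθZ(ρσ³)𝟙, (E+p)u) as
functions of U (local
    equilibrium in the weak sense) up to a concentration defect dominated by the energy defect, and
the thermodynamic
    entropy inequality ∂_t(ρs) + div(ρsu) ≥ 0 holds (s = 3/2 log θ − log ρ − f_ex(ρσ³));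
(b) WEAK–STRONG UNIQUENESS [PDE theorem to be formalised]: a dissipative mv solution of the complete
Euler system with a
    thermodynamically stable EOS emanating from smooth data coincides with the classical solution on
its lifespan
    (BrezinaFeireisl2018; GwiazdaSwierczewskagwiazdaWiedemann2015; Dafermos1979 relative entropy);
(c) initial data: at t = 0 the limit Young measure is the Dirac mass at U(0) (from the hypothesis of
HydrodynamicLimitFor
    upgraded by LocalGibbsConcentration).
(a)+(b)+(c) ⇒ the limit Young measure is δ_{U(t,x)} for t < T ⇒ L2HydroFields (typed target, shared
with route
DenseKineticExpansion) ⇒ HydrodynamicLimit. Typed today: L2HydroFields, Assembly (L2HydroFields →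
HydrodynamicLimit),
HsEntropyConvex (strict convexity of −ρs in conserved variables at packing fraction < η₀ — the
structural input of (b)),
HsEulerLocalExistence (Kato/Majda local classical solutions for the hs-EOS — non-vacuity of the
conjunct's hypothesis).

Rationale: WHY THIS LINE. Every other route proves STRONG local equilibrium (entropy or cumulants).
Hyperbolic-PDE theory offers a
cheaper currency: since Dafermos1979 (relative entropy/energy) and DiPerna's measure-valued
solutions, one knows that
ANY dissipative measure-valued solution agrees with the classical solution while the latter exists —
weak–strong
uniqueness, proved for compressible isentropic Euler mv solutions in
GwiazdaSwierczewskagwiazdaWiedemann2015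
(arXiv:1503.05246, Thm 1.1-type) and for the COMPLETE Euler system in BrezinaFeireisl2018 (J. Math.
Soc. Japan 70;
Brenier–De Lellis–Székelyhidi 2011 for the incompressible prototype). So before the first shock it
suffices that limit
points of the particle fields are dissipative mv solutions: a WEAK closure statement (fluxes are
EOS-functions of the
conserved fields on average, plus the second law) instead of pointwise local Gibbs structure. This
is how Vlasov/
Cucker–Smale/Euler-alignment limits are now derived (Carrillo,
Debiec–Gwiazda–Świerczewska-Gwiazda–Tzavaras relative
entropy method for mv limits); it has not been tried for deterministic hard spheres. Imported area:
hyperbolic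
conservation laws — Young measures, concentration defect measures, relative energy. brief=widen: PDE
stability theory
replaces half of the probabilistic work; the microscopic input shrinks to (a).

RANKED CRUXES.
 2. FluxClosure [informal]: tightness + identification of the limiting momentum/energy fluxes as
Young-measure averages of
    the hs-Euler flux functions of the conserved fields (weak local equilibrium), with concentration
defect controlled by
    the energy defect. This is where the deterministic dynamics must be used (mesoscopic
virialisation of the collisional
    momentum transfer; time averages replace ensemble ergodicity).
 3. EntropyAdmissibility [informal]: the limit points satisfy the thermodynamic entropy inequality
for the hs entropy
    s(ρ,θ) — microscopic origin: Gibbs/Shannon entropy of mesoscopic blocks is non-decreasing under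
measure-preserving
    dynamics + coarse-graining, and converges to −∫ρs by LocalGibbsConcentration/large deviations (a
Boltzmann-H-theorem
    substitute WITHOUT a kinetic equation).
 4. MvWeakStrongUniquenessHS [informal→typable once mv solutions are defined]:
BrezinaFeireisl2018-type theorem for the
    hs EOS on 𝕋³ (needs HsEntropyConvex; the hs gas is a "thermodynamically stable general EOS" in
their sense: p = ρθZ,
    e = 3θ/2, c_v = 3/2 > 0, ∂_ρ p > 0 at small packing fraction).
 5. HsEntropyConvex [typed]: strict convexity of U ↦ −ρ s(U) on {ρ > 0, ρσ³ < η₀, θ(U) > 0}; follows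
from HsEosLowDensity
    ((ηZ)′ = 1 + 2ηf′ + η²f″ > 0 near 0) — cheap, but it is the exact hypothesis of crux 4.
 TARGET [typed, shared] L2HydroFields; ASSEMBLY [typed, shared] L2HydroFields → HydrodynamicLimit;
 SUPPORT [typed] HsEulerLocalExistence (Majda1984 Thm 2.1 / Kato 1975 for symmetrisable hyperbolic
systems).
KILL CRITERIA. FluxClosure false (persistent mesoscopic velocity–position correlations making the
averaged momentum flux
differ from ρu⊗u + p𝟙 at leading order for some smooth pre-shock data) closes the route and would
strongly suggest
¬HydrodynamicLimit — file ¬HydrodynamicLimitFor as a statement then. Weak–strong uniqueness cannot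
be refuted (theorem).
If EntropyAdmissibility is unobtainable but FluxClosure holds, switch (b) to the "dissipative
solutions à la Lions"
variant that needs only the relative-energy inequality tested against smooth fields.
NOT DECOMPOSED YET: definitions of Young-measure-valued solutions on 𝕋³ (definition request deferred
until crux 2 has a
grounder), the defect measures, the passage subsequence → full sequence (automatic from uniqueness
of the limit).
SOURCES: Dafermos1979; GwiazdaSwierczewskagwiazdaWiedemann2015; BrezinaFeireisl2018; Majda1984;
DiPernaMajda1987 (mv/
concentration formalism); Spohn1991 I.3 (currents (3.6)–(3.8), virial (3.15)); Ruelle1969;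
LebowitzPenrose1964.

Novelty: Searches (2026-08-15): `lit search --hybrid "dissipative measure-valued solution weak-strong
uniqueness complete Euler consistent approximation convergence"` (12 held: feireisl2022 open fluid
systems, dafermos2005, markfelder2021, kipnis1999 Ch. 8, saint-raymond2009 — none particle-side for
systems); `lit search --source arxiv` "Feireisl Lukacova-Medvidova … dissipative measure-valued"
(arXiv:1803.08401), "… Monte Carlo random" (arXiv:2205.04125), "K-convergence" (arXiv:1904.00297,
arXiv:1910.03161); `lit galaxy search "dissipative measure-valued solutions" --star all` (8 rows:
arXiv:1801.01030, arXiv:2205.04076, Feireisl lecture notes; nothing on particles), `lit galaxy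
search "weak-strong uniqueness" --star pdf` (12 rows; particle-side only a gradient porous-medium
model); `lit frontier AtomisticToContinuum --since 2021` (30 rows, none on measure-valued /
relative-energy limits of hard spheres); OpenAlex and Semantic Scholar rate-limited today (noted in
NOTES.md); board read via ledger: StatisticalGermanoSplit, EntropyBookkeeping, LaxEquivalence,
EmpiricalEnskogDuality (all 2026-08-15).
Nearest prior art found: BrezinaFeireisl2018 (Def 2.9 + Thm 3.3, DMV weak–strong uniqueness for the
complete Euler system); FeireislLukacovamedvidovaMizerova2018, arXiv:1904.00297 and
FeireislEtAl2022MonteCarlo (consistent numerical approximations, also with random data, converge to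
the strong solution via DMV weak–strong uniqueness); Rezakhanlou1991 / KipnisLandim1999 Ch. 8
(particle system  [refs: 1803.08401, 2205.04125, 1904.00297, 1910.03161, 1801.01030, 2205.04076, BrezinaFeireisl2018, FeireislLukacovamedvidovaMizerova2018, Rezakhanlou1991, KipnisLandim1999, GwiazdaSwierczewskagwiazdaWiedemann2015, GwiazdaKremlSwierczewskagwiazda2018]

Barriers (technique_class: measure-valued weak-strong-uniqueness relative-energy): - technique_class: measure-valued weak-strong-uniqueness relative-energy
- Literature.Barriers.AtomisticToContinuum.WildSolutionsBarrier: evaded by construction — uniqueness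
is invoked only against the CLASSICAL solution on [0,T) (BF18 Thm 3.3 relative energy), never among
weak/measure-valued solutions; nothing post-shock is claimed (its caveat (c)).
- Literature.Barriers.AtomisticToContinuum.ShockFormationBarrier: conceded and inactive —
RelativeEnergyStability presupposes the strong solution exactly as the conjunct does (T = any
classical existence time); no post-shock strengthening attempted.
- Literature.Barriers.AtomisticToContinuum.ShockFormationBarrierNarrow: same — the reference state
IS the unshifted classical solution (BF18 sub-family); the record blocks only post-shock uses, none
here.
- Literature.Barriers.AtomisticToContinuum.NoBVEstimatesMultiDBarrier: evaded (its evasions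
(i)/(iii)) — L²/relative-energy framework in expectation; no BV, Glimm, front-tracking or Lᵖ (p ≠ 2)
stability is used.
- Literature.Barriers.AtomisticToContinuum.BoltzmannHypothesisBarrier: it does not fully evade it;
the bet is that FluxClosure needs only the WEAK identification "box momentum flux = m̂⊗m̂/ρ̂ + p(Û)𝟙
in L¹(P⊗dt⊗dx)" (second moments, trace fixed by Ê: isotropy + virial) and EntropyAdmissibility only
an inequality in expectation — not the classification of regular stationary states as Gibbs
mixtures; the barrier's ideal-gas kernel (any velocity law h with the right five moments

History (route lifecycle, newest last):
- 2026-08-15T13:41:49Z · CLOSED retired — not-a-thesis: assembly does not conclude the sub-problem Statement (operator:999:1257524)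

sub-problem: HydrodynamicLimit · status: closed(retired) · opened planner-plan-AtomisticToContinuum-HydrodynamicLimit-0 2026-08-13T19:14:13Z · rev 2 · ledger route-AtomisticToContinuum-DissipativeWeakStrong
GENERATED by the gate from the ledger (D-0016/17). Provers cite these decls: `theorem foo : Summit.AtomisticToContinuum.HydrodynamicLimit.Theses.DissipativeWeakStrong.<Decl> := …` in Summits/AtomisticToContinuum/HydrodynamicLimit/Theorems/<Name>.lean.
-/

namespace Summit.AtomisticToContinuum.HydrodynamicLimit.Theses.DissipativeWeakStrong

open scoped BigOperators Topology Manifold Classical MeasureTheory ProbabilityTheory Matrix InnerProductSpace ComplexConjugate ContinuousMap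
open Filter Set Function TopologicalSpace MeasureTheory

attribute [summit_statement] _root_.HydrodynamicLimit

/-- item stmt-AtomisticToContinuum-0800 · target · rank 0 · closed · moot by None · by planner
why it might fail: in substance the open conjunct (mean-square form); this route no longer enters it (dropped in the same repair: relative energy yields L¹(P⊗dx), not L², control of the energy field)
sources: Spohn1991, OllaVaradhanYau1993
[target] Mean-square hydrodynamic limit (typed shadow of one- and two-point cumulant control): for
all continuous profiles ∃ σ₀ ∀ σ<σ₀ ∀ classical hs-Euler solutions on [0,T) ∀ flows, if the local
Gibbs fields converge at t = 0 then for every t < T and continuous χ the lower integrals ∫⁻ |density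
field(Φ_t z; χ) − ∫χρ_t|², ∫⁻ ‖momentum field − ∫χρ_t u_t‖², ∫⁻ |energy field − ∫χE_t|² against
localGibbsLaw σ a₀ u₀ θ₀ N tend to 0 in ℝ≥0∞ (lintegral: no Bochner junk). Stronger than
TendstoHydroFieldsAt (adds uniform integrability); delivered by 1-marginal → local Maxwellian in
(1+|v|²)-weighted L¹ and 2-marginal → product. -/
@[route_item "route-AtomisticToContinuum-DissipativeWeakStrong"]
def L2HydroFields : Prop :=
  ∀ (a₀ θ₀ : Literature.MathematicalPhysics.KineticTheory.T3 → ℝ) (u₀ : Literature.MathematicalPhysics.KineticTheory.T3 → Literature.MathematicalPhysics.KineticTheory.V3), Continuous a₀ → Continuous θ₀ → Continuous u₀ → (∀ x, 0 < a₀ x) → (∀ x, 0 < θ₀ x) → ∃ σ₀ : ℝ, 0 < σ₀ ∧ ∀ σ : ℝ, 0 < σ → σ < σ₀ → ∀ (T : ℝ) (ρ θ : ℝ → Literature.MathematicalPhysics.KineticTheory.T3 → ℝ) (u : ℝ → Literature.MathematicalPhysics.KineticTheory.T3 → Literature.MathematicalPhysics.KineticTheory.V3), Literature.MathematicalPhysics.KineticTheory.IsHardSphereEulerSolution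 σ T ρ u θ → ∀ Φ : (N : ℕ) → Literature.Analysis.FluidPDE.HardSphereFlow (Literature.Analysis.FluidPDE.Torus.geometry (Fin 3)) (Literature.MathematicalPhysics.KineticTheory.hsDiameter σ N) (N + 1), Literature.MathematicalPhysics.KineticTheory.TendstoHydroFieldsAt (fun N => Literature.MathematicalPhysics.KineticTheory.localGibbsLaw σ a₀ u₀ θ₀ N (Φ N)) Φ ρ u θ 0 → ∀ t ∈ Set.Ico 0 T, ∀ χ : Literature.MathematicalPhysics.KineticTheory.T3 → ℝ, Continuous χ → Filter.Tendsto (fun N : ℕ => ∫⁻ z, ENNReal.ofReal (|Literature.MathematicalPhysics.KineticTheory.empiricalDensityField ((Φ N).flow t z) χ - ∫ x, χ x * ρ t x| ^ 2) ∂(Literature.MathematicalPhysics.KineticTheory.localGibbsLaw σ a₀ u₀ θ₀ N (Φ N))) Filter.atTop (nhds 0) ∧ Filter.Tendsto (fun N : ℕ => ∫⁻ z, ENNReal.ofReal (‖Literature.MathematicalPhysics.KineticTheory.empiricalMomentumField ((Φ N).flow t z) χ - ∫ x, (χ x * ρ t x) • u t x‖ ^ 2) ∂(Literature.MathematicalPhysics.KineticTheory.localGibbsLaw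 σ a₀ u₀ θ₀ N (Φ N))) Filter.atTop (nhds 0) ∧ Filter.Tendsto (fun N : ℕ => ∫⁻ z, ENNReal.ofReal (|Literature.MathematicalPhysics.KineticTheory.empiricalEnergyField ((Φ N).flow t z) χ - ∫ x, χ x * Literature.MathematicalPhysics.KineticTheory.totalEnergyDensity (ρ t x) (u t x) (θ t x)| ^ 2) ∂(Literature.MathematicalPhysics.KineticTheory.localGibbsLaw σ a₀ u₀ θ₀ N (Φ N))) Filter.atTop (nhds 0)

-- item stmt-AtomisticToContinuum-0823 · crux · rank 2 · closed · moot by None · by planner — informal only, no Lean statement yet: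
--   [crux] WEAK LOCAL EQUILIBRIUM (flux closure): for σ < σ₀, local Gibbs data and t < T, along every
--   subsequence N_k the laws of the empirical space-time fields (U_N, J_N) — U_N = (density, momentum,
--   energy) fields, J_N = time-integrated empirical momentum-flux tensor Σ_i χ(x_i)v_i⊗v_i + collisional
--   transfer Σ_{collisions} χ·(momentum jump)⊗(εω) and energy flux — are tight as random Radon measures
--   on [0,T)×𝕋³, and every limit point is a.s. a measure-valued solution: there is a Young measure
--   ν_{t,x} on state space {ρ ≥ 0, m, E} with U = ⟨ν, id⟩ and J = ⟨ν, F_σ⟩ + concentration defect m_D,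
--   where F_

-- item stmt-AtomisticToContinuum-0824 · crux · rank 3 · closed · moot by None · by planner — informal only, no Lean statement yet:
--   [crux] SECOND LAW FOR LIMIT POINTS: every limit Young measure of FluxClosure satisfies the entropy
--   inequality ∂_t⟨ν, ρs⟩ + div⟨ν, ρsu⟩ ≥ 0 in D′((0,T)×𝕋³) with the hard-sphere entropy s(ρ,θ) = 3/2
--   log θ − log ρ − hsExcessFreeEnergy(ρσ³), and ⟨ν_{0,x}, ·⟩ = δ_{U(0,x)}. Microscopic mechanism
--   proposed: block Shannon entropies of the time-t law are controlled by Liouville invariance +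
--   subadditivity, and the large-deviation functional of local Gibbs states (LocalGibbsConcentration,
--   stmt-AtomisticToContinuum-0767) identifies their limit with −∫⟨ν, ρs⟩; the inequality is the
--   contraction of relative e

-- item stmt-AtomisticToContinuum-0825 · crux · rank 4 · closed · moot by None · by planner — informal only, no Lean statement yet:
--   [crux; PDE, typable after a definition of dissipative mv solutions on 𝕋³] WEAK–STRONG UNIQUENESS FOR
--   THE hs-EULER SYSTEM: let (ρ,u,θ) be a classical solution (IsHardSphereEulerSolution σ T ρ u θ) with
--   ρσ³ < η₀, and ν a dissipative measure-valued solution of the same system on [0,T)×𝕋³ in the sense of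
--   BrezinaFeireisl2018 (conservation laws with concentration defect dominated by the energy defect,
--   entropy inequality for s = 3/2 log θ − log ρ − f_ex(ρσ³), energy compatibility) with ν_{0,x} =
--   δ_{(ρ,ρu,E)(0,x)}; then ν_{t,x} = δ_{(ρ,ρu,E)(t,x)} for a.e. (t,x), t < T, and the defect vanishes.
--   Proof

/-- item stmt-AtomisticToContinuum-0817 · support · rank 5 · closed · moot by None · by planner
sources: Dafermos2005, BrezinaFeireisl2018, Ruelle1969
[crux] Thermodynamic stability of the hard-sphere gas at low packing fraction: ∃ η₀ > 0 such that
for every σ > 0 the mathematical entropy U = (ρ, m, E) ↦ −ρ·(3/2·log θ(U) − log ρ −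
hsExcessFreeEnergy(ρσ³)), θ(U) = (2/3)(E/ρ − |m|²/(2ρ²)), is STRICTLY CONVEX on the convex set {ρ >
0, ρσ³ < η₀, |m|² < 2ρE}. Proof sketch: s(τ, e) = 3/2 log e + log τ − f_ex(σ³/τ) is strictly concave
in (τ = 1/ρ, e) iff (ηZ)′(η) = 1 + 2ηf′_ex + η²f″_ex > 0, true for η < η₀ by HsEosLowDensity (f_ex
analytic, f′_ex(0) = 2π/3); then the standard perspective argument (Dafermos, Hyperbolic
Conservation Laws, §2.x; Harten) gives strict convexity of −ρ s in conserved variables. Exact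
hypothesis of relative-energy weak–strong uniqueness (BrezinaFeireisl2018, Dafermos1979). -/
@[route_item "route-AtomisticToContinuum-DissipativeWeakStrong"]
def HsEntropyConvex : Prop :=
  (∃ η₀ : ℝ, 0 < η₀ ∧ ∃ F : ℝ → ℝ, AnalyticOnNhd ℝ F (Set.Ioo (-η₀) η₀) ∧ Set.EqOn Literature.MathematicalPhysics.KineticTheory.hsExcessFreeEnergy F (Set.Ico 0 η₀) ∧ F 0 = 0 ∧ deriv F 0 = 2 * Real.pi / 3 ∧ ∀ η ∈ Set.Ico 0 η₀, Filter.Tendsto (fun N : ℕ => -(N : ℝ)⁻¹ * Real.log (Literature.MathematicalPhysics.KineticTheory.hsFreeVolume η N)) Filter.atTop (nhds (F η))) → ∃ η₀ : ℝ, 0 < η₀ ∧ ∀ σ : ℝ, 0 < σ → StrictConvexOn ℝ {U : ℝ × Literature.MathematicalPhysics.KineticTheory.V3 × ℝ | 0 < U.1 ∧ U.1 * σ ^ 3 < η₀ ∧ ‖U.2.1‖ ^ 2 < 2 * U.1 * U.2.2} (fun U : ℝ × Literature.MathematicalPhysics.KineticTheory.V3 × ℝ => -(U.1 * (3 / 2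 * Real.log (2 / 3 * (U.2.2 / U.1 - ‖U.2.1‖ ^ 2 / (2 * U.1 ^ 2))) - Real.log U.1 - Literature.MathematicalPhysics.KineticTheory.hsExcessFreeEnergy (U.1 * σ ^ 3))))

/-- item stmt-AtomisticToContinuum-0818 · support · rank 9 · closed · moot by None · by planner
[support] Local classical well-posedness of the hard-sphere compressible Euler system on 𝕋³: ∃ η₀ >
0 ∀ σ > 0 ∀ smooth (Torus.IsSmooth) data ρ₀, θ₀ > 0, u₀ with ρ₀σ³ < η₀ pointwise, ∃ T > 0 and a
classical solution (IsHardSphereEulerSolution σ T ρ u θ) with these initial values. Majda1984 Thm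
2.1 (Kato 1975) for symmetrisable hyperbolic systems; symmetriser from HsEntropyConvex /
HsEosLowDensity (p = ρθZ(ρσ³) smooth with ∂_ρp > 0, ∂_θp > 0). Non-vacuity guard for the conjunct's
hypothesis `IsHardSphereEulerSolution`; shared by all routes. -/
@[route_item "route-AtomisticToContinuum-DissipativeWeakStrong"]
def HsEulerLocalExistence : Prop :=
  ∃ η₀ : ℝ, 0 < η₀ ∧ ∀ σ : ℝ, 0 < σ → ∀ (ρ₀ θ₀ : Literature.MathematicalPhysics.KineticTheory.T3 → ℝ) (u₀ : Literature.MathematicalPhysics.KineticTheory.T3 → Literature.MathematicalPhysics.KineticTheory.V3), Literature.Analysis.FunctionSpaces.Torus.IsSmooth ρ₀ → Literature.Analysis.FunctionSpaces.Torus.IsSmooth θ₀ → Literature.Analysis.FunctionSpaces.Torus.IsSmooth u₀ → (∀ x, 0 < ρ₀ x) → (∀ x, 0 < θ₀ x) → (∀ x, ρ₀ x * σ ^ 3 < η₀) → ∃ T : ℝ, 0 < T ∧ ∃ (ρ θ : ℝ → Literature.MathematicalPhysics.KineticTheory.T3 → ℝ) (u : ℝ → Literature.MathematicalPhysics.KineticTheory.T3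 → Literature.MathematicalPhysics.KineticTheory.V3), Literature.MathematicalPhysics.KineticTheory.IsHardSphereEulerSolution σ T ρ u θ ∧ ρ 0 = ρ₀ ∧ u 0 = u₀ ∧ θ 0 = θ₀

/-- item stmt-AtomisticToContinuum-0801 · assembly · rank 1 · closed · moot by None · by planner
[assembly] L2HydroFields → HydrodynamicLimit: Markov/Chebyshev in ℝ≥0∞
(MeasureTheory.meas_ge_le_lintegral_div or mul_meas_ge_le_lintegral): P{δ < |F|} ≤ δ⁻² ∫⁻ ofReal
|F|², measurability of z ↦ field((Φ N).flow t z) from measurable_flow and continuity of χ (or use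
the outer-measure form), then squeeze. -/
@[route_item "route-AtomisticToContinuum-DissipativeWeakStrong"]
def Assembly : Prop :=
  L2HydroFields → Literature.MathematicalPhysics.KineticTheory.HydrodynamicLimit

end Summit.AtomisticToContinuum.HydrodynamicLimit.Theses.DissipativeWeakStrong
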